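import Mathlib
import Summits.Ventures.PercRepro.TriangleCapEqualityLocusLine

/-!
# PercRepro — THE CUBIC SIX-CORE, I: `K_{3,3}` and the prism on a six-set, the three-neighbour lemmas, and
the prism from a triangle with its matching fixed (p3, gen 42; part 175)

The hang family of the line `k − r = 6` (part 172) grows on a six-set `C` on which `D` is cubic.  Part 176
classifies the core as `K_{3,3}` or the prism; this module holds the two shapes (`IsK33On`: a three-set
`P ⊆ C` with the inner edges exactly the pairs crossing `P`; `IsPrismOn`: two triangles `a₁a₂a₃`, `b₁b₂b₃`
joined by the rungs `aᵢbᵢ` and nothing else), the two counting lemmas about a vertex with exactly three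
neighbours in `C` (`nbhd_eq_of_three`: three given neighbours are all of them; `adj_of_nbhd_subset_three`:
neighbours only among three given vertices means all three), and the triangle case with its matching fixed
(`prism_of_triangle_matching`): from a vertex `v` with neighbours `a, b, c` and non-neighbours `p, q`, with
`a ∼ b`, `a ∼ p`, `b ∼ q`, `K₄⁻`-freeness forbids `c ∼ a`, `c ∼ b`, so `c ∼ p, q` and `p ∼ q` — the prism
`v a b | c p q` with the rungs `v c`, `a p`, `b q`.  Axioms: standard.
-/

namespace PercRepro

namespace TriangleCap

namespace C047

open Finset

variable {V : Type*} [Fintype V] [DecidableEq V]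

omit [Fintype V] in
/-- **`D` INDUCES `K_{3,3}` ON `C`:** a three-set `P ⊆ C` with the edges inside `C` exactly the pairs crossing `P`. -/
def IsK33On (D : SimpleGraph V) [DecidableRel D.Adj] (C : Finset V) : Prop :=
  ∃ P : Finset V, P ⊆ C ∧ P.card = 3 ∧ ∀ u ∈ C, ∀ w ∈ C, (D.Adj u w ↔ (u ∈ P ↔ w ∉ P))

omit [Fintype V] in
/-- **`D` INDUCES THE PRISM ON `C`:** two triangles `a₁a₂a₃`, `b₁b₂b₃` and the three rungs `aᵢbᵢ`, nothing
else (`C` has six elements, so the six vertices are distinct). -/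
def IsPrismOn (D : SimpleGraph V) [DecidableRel D.Adj] (C : Finset V) : Prop :=
  ∃ a₁ a₂ a₃ b₁ b₂ b₃ : V, C = {a₁, a₂, a₃, b₁, b₂, b₃} ∧ C.card = 6 ∧
    D.Adj a₁ a₂ ∧ D.Adj a₂ a₃ ∧ D.Adj a₁ a₃ ∧ D.Adj b₁ b₂ ∧ D.Adj b₂ b₃ ∧ D.Adj b₁ b₃ ∧
    D.Adj a₁ b₁ ∧ D.Adj a₂ b₂ ∧ D.Adj a₃ b₃ ∧
    ¬ D.Adj a₁ b₂ ∧ ¬ D.Adj a₁ b₃ ∧ ¬ D.Adj a₂ b₁ ∧ ¬ D.Adj a₂ b₃ ∧ ¬ D.Adj a₃ b₁ ∧ ¬ D.Adj a₃ b₂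

omit [Fintype V] in
/-- A vertex with three neighbours in `C`, three of them given: every neighbour in `C` is one of them. -/
theorem nbhd_eq_of_three (D : SimpleGraph V) [DecidableRel D.Adj] {C : Finset V} {u : V}
    (hu : degIn D C u = 3) {x y z : V} (hx : x ∈ C) (hy : y ∈ C) (hz : z ∈ C) (hxy : x ≠ y) (hxz : x ≠ z)
    (hyz : y ≠ z) (hux : D.Adj u x) (huy : D.Adj u y) (huz : D.Adj u z) :
    ∀ w ∈ C, D.Adj u w → (w = x ∨ w = y ∨ w = z) := by
  have hsub : ({x, y, z} : Finset V) ⊆ C.filter (fun w => D.Adj u w) := by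
    intro w hw
    simp only [mem_insert, mem_singleton] at hw
    rw [mem_filter]
    rcases hw with rfl | rfl | rfl
    · exact ⟨hx, hux⟩
    · exact ⟨hy, huy⟩
    · exact ⟨hz, huz⟩
  have hcard : ({x, y, z} : Finset V).card = 3 := by
    rw [card_insert_of_notMem, card_pair hyz]
    simp only [mem_insert, mem_singleton, not_or]
    exact ⟨hxy, hxz⟩
  have heq : ({x, y, z} : Finset V) = C.filter (fun w => D.Adj u w) :=
    eq_of_subset_of_card_le hsub (by unfold degIn at hu; omega)
  intro w hw hadj
  have : w ∈ ({x, y, z} : Finset V) := by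
    rw [heq, mem_filter]
    exact ⟨hw, hadj⟩
  simpa only [mem_insert, mem_singleton] using this

omit [Fintype V] in
/-- A vertex with three neighbours in `C`, all among three given vertices of `C`: it is adjacent to all three. -/
theorem adj_of_nbhd_subset_three (D : SimpleGraph V) [DecidableRel D.Adj] {C : Finset V} {u : V}
    (hu : degIn D C u = 3) {x y z : V} (hxy : x ≠ y) (hxz : x ≠ z) (hyz : y ≠ z)
    (hsub : ∀ w ∈ C, D.Adj u w → (w = x ∨ w = y ∨ w = z)) : D.Adj u x ∧ D.Adj u y ∧ D.Adj u z := by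
  have hsub' : C.filter (fun w => D.Adj u w) ⊆ ({x, y, z} : Finset V) := by
    intro w hw
    rw [mem_filter] at hw
    simp only [mem_insert, mem_singleton]
    exact hsub w hw.1 hw.2
  have hcard : ({x, y, z} : Finset V).card = 3 := by
    rw [card_insert_of_notMem, card_pair hyz]
    simp only [mem_insert, mem_singleton, not_or]
    exact ⟨hxy, hxz⟩
  have heq : C.filter (fun w => D.Adj u w) = ({x, y, z} : Finset V) :=
    eq_of_subset_of_card_le hsub' (by unfold degIn at hu; omega)
  have hmem : ∀ w ∈ ({x, y, z} : Finset V), D.Adj u w := by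
    intro w hw
    rw [← heq, mem_filter] at hw
    exact hw.2
  exact ⟨hmem x (by simp), hmem y (by simp), hmem z (by simp)⟩

/-- **THE TRIANGLE CASE, THE MATCHING FIXED:** with `v ∼ a, b, c`, `v ≁ p, q`, `a ∼ b`, `a ∼ p` and `b ∼ q` the
core is the prism `v a b | c p q` with the rungs `v c`, `a p`, `b q`. -/
theorem prism_of_triangle_matching (D : SimpleGraph V) [DecidableRel D.Adj] (hK : K4mFree D)
    {C : Finset V} {v a b c p q : V} (hCeq : C = {v, a, b, c, p, q}) (hC : C.card = 6)
    (hcub : ∀ c ∈ C, degIn D C c = 3)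
    (hva' : v ≠ a) (hvb' : v ≠ b) (hvc' : v ≠ c) (hvp' : v ≠ p) (hvq' : v ≠ q) (hab' : a ≠ b) (hac' : a ≠ c)
    (hap' : a ≠ p) (haq' : a ≠ q) (hbc' : b ≠ c) (hbp' : b ≠ p) (hbq' : b ≠ q) (hcp' : c ≠ p) (hcq' : c ≠ q)
    (hpq' : p ≠ q) (hva : D.Adj v a) (hvb : D.Adj v b) (hvc : D.Adj v c) (hvp : ¬ D.Adj v p)
    (hvq : ¬ D.Adj v q) (hab : D.Adj a b) (hap : D.Adj a p) (hbq : D.Adj b q) : IsPrismOn D C := by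
  have hmem : ∀ w ∈ C, w = v ∨ w = a ∨ w = b ∨ w = c ∨ w = p ∨ w = q := by
    intro w hw
    rw [hCeq] at hw
    simpa only [mem_insert, mem_singleton] using hw
  have hvC : v ∈ C := by rw [hCeq]; simp
  have haC : a ∈ C := by rw [hCeq]; simp
  have hbC : b ∈ C := by rw [hCeq]; simp
  have hcC : c ∈ C := by rw [hCeq]; simp
  have hpC : p ∈ C := by rw [hCeq]; simp
  have hqC : q ∈ C := by rw [hCeq]; simp
  -- `K₄⁻`-freeness: `c ≁ a`, `c ≁ b`
  have hac : ¬ D.Adj a c := fun h => not_adj_both D hK hva hvb hab hbc' hvc h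
  have hbc : ¬ D.Adj b c := fun h => not_adj_both D hK hvb hva (D.adj_symm hab) hac' hvc h
  -- the neighbourhoods of `a` and `b`
  have hNa := nbhd_eq_of_three D (hcub a haC) hvC hbC hpC hvb' hvp' hbp' (D.adj_symm hva) hab hap
  have hNb := nbhd_eq_of_three D (hcub b hbC) hvC haC hqC hva' hvq' haq' (D.adj_symm hvb) (D.adj_symm hab) hbq
  have haq : ¬ D.Adj a q := fun h => by
    rcases hNa q hqC h with h1 | h1 | h1
    · exact hvq' h1.symm
    · exact hbq' h1.symm
    · exact hpq' h1.symm
  have hbp : ¬ D.Adj b p := fun h => by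
    rcases hNb p hpC h with h1 | h1 | h1
    · exact hvp' h1.symm
    · exact hap' h1.symm
    · exact hpq' h1
  -- `c ∼ p, q`
  have hNc := adj_of_nbhd_subset_three D (hcub c hcC) hvp' hvq' hpq' (fun w hw hcw => by
    rcases hmem w hw with rfl | rfl | rfl | rfl | rfl | rfl
    · exact Or.inl rfl
    · exact absurd (D.adj_symm hcw) hac
    · exact absurd (D.adj_symm hcw) hbc
    · exact absurd hcw (D.irrefl)
    · exact Or.inr (Or.inl rfl)
    · exact Or.inr (Or.inr rfl))
  obtain ⟨-, hcp, hcq⟩ := hNc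
  -- `p ∼ q`
  have hNp := adj_of_nbhd_subset_three D (hcub p hpC) hac' haq' hcq' (fun w hw hpw => by
    rcases hmem w hw with rfl | rfl | rfl | rfl | rfl | rfl
    · exact absurd (D.adj_symm hpw) hvp
    · exact Or.inl rfl
    · exact absurd (D.adj_symm hpw) hbp
    · exact Or.inr (Or.inl rfl)
    · exact absurd hpw (D.irrefl)
    · exact Or.inr (Or.inr rfl))
  obtain ⟨-, -, hpq⟩ := hNp
  refine ⟨v, a, b, c, p, q, hCeq, hC, hva, hab, hvb, hcp, hpq, hcq, hvc, hap, hbq, hvp, hvq, hac, haq, hbc,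
    hbp⟩

end C047

end TriangleCap

end PercRepro
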